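import Literature.NumberTheory.ComplexMultiplication.CMTypeRankOverSubtype
import Literature.NumberTheory.ComplexMultiplication.CMTypeRankLowerBounds
import HarnessLib

/-!
# Balanced transversals of a CM type of corank one form a single Galois block `{Ψ, Ψ̄}`

Abstract setting of `CMTypeRank.lean` (a group `G` acting on a finite set `E` of "embeddings", a central
fixed-point-free involution `ρ` — complex conjugation — and a CM type `Φ ⊆ E`, `IsCMTypeWith ρ Φ`; in print
`G = Gal(Kᶜ/ℚ)` or `Aut(ℂ)`, `E = Hom(K, ℂ)`, `|E| = 2n`).  Everything here is PROVED; no definition, no named fact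
(D-0014/D-0026).  Written for the Pohlmann 1968 / Weil 1977 literature line of the COR-CM cell (`pub-hodgecm2`):
it is the combinatorial heart of "on a SIMPLE CM abelian fourfold the exceptional Hodge classes are Weil classes
of an imaginary quadratic subfield" (Moonen–Zarhin; Weil's observation on Mumford's example, van Geemen 4.7),
see `Literature/AlgebraicGeometry/Pohlmann1968/SimpleCMFourfoldWeilType.lean`.

## What is proved

A **transversal** `Ψ ⊆ E` is a set meeting every conjugate pair `{x, ρx}` exactly once (`x ∈ Ψ ↔ ρx ∉ Ψ` — as a set,
a CM type).  Pohlmann's Galois condition (9.2.1) for `Ψ` with respect to `Φ` ("`|gΨ ∩ Φ| = |gΨ ∩ Φ̄|` for all `g`",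
`IsBalanced G Φ 𝟙_Ψ`) says that the weight class `⟨Ψ⟩ ∈ Hⁿ(A_Φ)` is a Hodge class (Pohlmann 1968 Thm. 1); since
`Ψ ≠ Ψ̄` it is then an EXCEPTIONAL one (not a product of divisor classes, Gordon 9.2.2).

* `IsCMTypeWith.smul_mem_iff_or_of_isBalanced` — **if `rank(Φ) ≥ n` (Kubota–Dodson rank `typeRank`, so the type is
  nondegenerate or degenerate by exactly one) then every balanced transversal `Ψ` is a BLOCK of the `G`-action with
  exactly the two translates `Ψ, Ψ̄`**: for every `g ∈ G`, either `gx ∈ Ψ ↔ x ∈ Ψ` for all `x`, or `gx ∈ Ψ ↔ x ∉ Ψ`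
  for all `x`.  Proof: the sign vectors `e_Ψ = 𝟙_Ψ − 𝟙_{Ψ̄}` and `e_{g⁻¹Ψ}` are `ρ`-anti-invariant and balanced,
  hence span a subspace `W` of anti-invariant balanced weights; by Kubota's defect count
  (`typeRank_add_finrank_le_of_balanced`: `rank + dim W ≤ n + 1`) `dim W ≤ 1`, so `e_{g⁻¹Ψ} = ± e_Ψ`.
* `IsCMTypeWith.smul_mem_iff_or_of_isBalanced_of_isBalanced` — the same for TWO balanced transversals `Ψ, Ψ'`:
  `Ψ' = Ψ` or `Ψ' = Ψ̄` (pointwise form) — for `|E| = 8` this is "a simple CM fourfold is of Weil type for at most one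
  imaginary quadratic subfield" in Pohlmann's coordinates.
* `IsCMTypeWith.index_stabilizer_eq_two_of_isBalanced` — consequently the set-stabiliser of `Ψ` has index `2` in `G`
  (`ρ` represents the non-trivial coset): in print, the subfield of `Kᶜ` fixed by it is an imaginary QUADRATIC field.
* `IsCMTypeWith.four_le_typeRank_of_card_eq_eight` — for `|E| = 8` and a PRIMITIVE type (the translates of `Φ`
  separate the points of `E`), `rank(Φ) ≥ 4 = n` by Ribet's `log₂`-bound (`two_mul_card_le_two_pow_typeRank`:
  `16 ≤ 2^{rank}`), so the block theorem applies to every simple CM abelian FOURFOLD.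

## Sources

* B. Moonen, Yu. Zarhin, *Hodge classes on abelian varieties of low dimension*, Math. Ann. 315 (1999) 711–733
  [MoonenZarhin1999LowDim] (arXiv:math/9901113), Thm. 0.1 with (1.4)–(1.9): on an abelian fourfold
  `B² = D² + Σ_k W_k` over the imaginary quadratic `k ⊂ End⁰` acting with multiplicities `(2,2)`; B. Moonen,
  Yu. Zarhin, *Hodge classes and Tate classes on simple abelian fourfolds*, Duke Math. J. 77 (1995) 553–581
  [MoonenZarhin1995Duke], the simple case.  The present file is the CM (type IV, commutative) case of the
  codimension-2 statement, in Pohlmann's coordinates; the proof (a rank count) is ours, not the printed one.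
* B. van Geemen, *An introduction to the Hodge conjecture for abelian varieties*, LNM 1594 (1994)
  [vanGeemen1994HodgeAV], 4.7 (Weil's observation on Mumford's CM fourfold: "the imaginary quadratic field was
  'responsible' for the exceptional Hodge cycles") and Thm. 4.12.
* B. B. Gordon, *A survey of the Hodge conjecture for abelian varieties* [Gordon1999HodgeAVSurvey], §9.2 (9.2.1),
  9.2.2 (White), §9.4 (rank, degenerate types), 5.13 (ii).
* The rank machinery: [Kubota1965] §2, [Dodson1987] §1.1, [Shimura1998] §32.10 — tree files `CMTypeRank.lean`,
  `CMTypeRankOverSubtype.lean`, `CMTypeRankLowerBounds.lean`.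
-/

set_option autoImplicit false

open scoped BigOperators Pointwise Classical

namespace Literature.NumberTheory.ComplexMultiplication

variable {G : Type*} [Group G] {E : Type*} [MulAction G E] [Fintype E]

/-! ### Translates of balanced weights -/

/-- **Pohlmann's condition is `G`-invariant**: if `f` satisfies (9.2.1) then so does `x ↦ f(g • x)` (the weight
of the translate `g⁻¹Δ`): `|k(g⁻¹Δ) ∩ Φ| = |(kg⁻¹)Δ ∩ Φ|`. [cite: Gordon1999HodgeAVSurvey, §9.2 (9.2.1)] -/
theorem IsBalanced.comp_smul {Φ : Set E} {f : E → ℚ} (hf : IsBalanced G Φ f) (g : G) :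
    IsBalanced G Φ (fun x => f (g • x)) := by
  intro k
  have h1 := hf (k * g⁻¹)
  have hb : Function.Bijective fun x : E => g • x := MulAction.bijective g
  have h2 : ∑ x, f (g • x) * translateInd Φ k x = ∑ y, f y * translateInd Φ (k * g⁻¹) y := by
    rw [← hb.sum_comp (fun y => f y * translateInd Φ (k * g⁻¹) y)]
    refine Finset.sum_congr rfl fun x _ => ?_
    rw [← translateInd_mul, inv_mul_cancel_right]
  have h3 : ∑ x, f (g • x) = ∑ y, f y := hb.sum_comp f
  rw [h2, h3]
  exact h1

/-- A weight orthogonal to every `u_g` stays orthogonal to `U = span{u_g}` under linear combinations: the weights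
orthogonal to all `u_g` form a subspace (used for the span of two sign vectors). [folklore] -/
private theorem dotProduct_antiVec_eq_zero_of_mem_span {Φ : Set E} {S : Set (E → ℚ)}
    (hS : ∀ s ∈ S, ∀ g : G, dotProduct s (antiVec Φ g) = 0) {w : E → ℚ} (hw : w ∈ Submodule.span ℚ S)
    (g : G) : dotProduct w (antiVec Φ g) = 0 := by
  induction hw using Submodule.span_induction with
  | mem s hs => exact hS s hs g
  | zero => exact zero_dotProduct _
  | add u v _ _ hu hv => rw [add_dotProduct, hu, hv, add_zero]
  | smul c u _ hu => rw [smul_dotProduct, hu, smul_zero]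

omit [Fintype E] in
/-- The indicator of the translate `{x | g • x ∈ Ψ} = g⁻¹Ψ` is `𝟙_Ψ ∘ (g • ·)`. [folklore] -/
private theorem indicator_preimage_smul (Ψ : Set E) (g : G) :
    ({x | g • x ∈ Ψ} : Set E).indicator (1 : E → ℚ) = fun x => Ψ.indicator 1 (g • x) := by
  classical
  funext x
  by_cases hx : g • x ∈ Ψ
  · have hx' : x ∈ ({x | g • x ∈ Ψ} : Set E) := hx
    simp [hx, hx']
  · have hx' : x ∉ ({x | g • x ∈ Ψ} : Set E) := hx
    simp [hx, hx']

/-- Auxiliary: `16 ≤ 2^r` forces `4 ≤ r`. [folklore] -/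
private theorem four_le_of_sixteen_le_two_pow {r : ℕ} (hr : 16 ≤ 2 ^ r) : 4 ≤ r := by
  by_contra hlt
  push Not at hlt
  have : 2 ^ r ≤ 2 ^ 3 := Nat.pow_le_pow_right (by norm_num) (by omega)
  omega

namespace IsCMTypeWith

variable {ρ : G} {Φ : Set E} (h : IsCMTypeWith ρ Φ)
include h

/-! ### The sign vector of a transversal -/

omit [Fintype E] in
/-- For a transversal `Ψ` (`x ∈ Ψ ↔ ρx ∉ Ψ`, i.e. a CM type as a set): `ρx ∈ Ψ ↔ x ∉ Ψ` — "`{φ₁, …, φₙ, φ₁ρ, …, φₙρ}` is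
exactly the set of all embeddings", the conjugate type is the complement. [cite: Shimura1998, §18.1] -/
theorem rho_smul_mem_iff_of_transversal {Ψ : Set E} (hΨ : ∀ x, x ∈ Ψ ↔ ρ • x ∉ Ψ) (x : E) :
    ρ • x ∈ Ψ ↔ x ∉ Ψ := by
  have h1 := hΨ (ρ • x)
  rw [h.invol] at h1
  tauto

/-- **The sign vector `e_Ψ = 𝟙_Ψ − 𝟙_Ψ̄` of a balanced transversal is a balanced, `ρ`-anti-invariant weight,
orthogonal to every `u_g = 2·𝟙_{g⁻¹Φ} − 1`** (`e_Ψ = 𝟙_Ψ − 𝟙_Ψ ∘ ρ`; Pohlmann's condition is linear and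
`ρ`-symmetric). [cite: Gordon1999HodgeAVSurvey, §9.2 (9.2.1)] -/
theorem sign_sub_isBalanced {Ψ : Set E} (hΨ : ∀ x, x ∈ Ψ ↔ ρ • x ∉ Ψ)
    (hbal : IsBalanced G Φ (Ψ.indicator 1)) {e : E → ℚ} (he : ∀ x, e x = if x ∈ Ψ then 1 else -1) :
    IsBalanced G Φ e ∧ (∀ x, e (ρ • x) = -e x) ∧ ∀ g : G, dotProduct e (antiVec Φ g) = 0 := by
  classical
  have hρΨ := h.rho_smul_mem_iff_of_transversal hΨ
  have hind : ∀ x, Ψ.indicator (1 : E → ℚ) x = if x ∈ Ψ then 1 else 0 := fun x => by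
    by_cases hx : x ∈ Ψ <;> simp [hx]
  have he_eq : e = Ψ.indicator 1 - fun x => Ψ.indicator 1 (ρ • x) := by
    funext x
    simp only [Pi.sub_apply, hind, he]
    by_cases hx : x ∈ Ψ
    · rw [if_pos hx, if_pos hx, if_neg ((hΨ x).1 hx)]; norm_num
    · rw [if_neg hx, if_neg hx, if_pos ((hρΨ x).2 hx)]; norm_num
  have hebal : IsBalanced G Φ e := by
    rw [he_eq]
    exact hbal.sub (h.isBalanced_comp_rho hbal)
  refine ⟨hebal, fun x => ?_, fun g => hebal.dotProduct_antiVec g⟩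
  rw [he, he]
  by_cases hx : x ∈ Ψ
  · rw [if_pos hx, if_neg ((hΨ x).1 hx)]
  · rw [if_neg hx, if_pos ((hρΨ x).2 hx)]; norm_num

/-! ### Two balanced transversals coincide up to complement (corank `≤ 1`) -/

/-- **Two balanced transversals of a type of corank `≤ 1` are equal or complementary.**  If `rank(Φ) ≥ n`
(`|E| = 2n`; `typeRank`, Kubota–Dodson) and `Ψ, Ψ'` are transversals (`x ∈ Ψ ↔ ρx ∉ Ψ`) whose indicators satisfy
Pohlmann's condition (9.2.1), then either `x ∈ Ψ' ↔ x ∈ Ψ` for all `x`, or `x ∈ Ψ' ↔ x ∉ Ψ` for all `x`.  The sign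
vectors `e_Ψ, e_{Ψ'}` span a space `W` of `ρ`-anti-invariant balanced weights, and Kubota's defect count
`rank + dim W ≤ n + 1` (`typeRank_add_finrank_le_of_balanced`) forces `dim W ≤ 1`, i.e. `e_{Ψ'} = ± e_Ψ`.  In print
(for `|E| = 8`): a simple CM fourfold is of Weil type `(2,2)` for AT MOST ONE imaginary quadratic subfield, and
`dim B² − dim D² ∈ {0, 2}` (Gordon 5.13 (ii) "`dim Hdg²(A) = 8`, and `dim Div²(A) = 6`").
[cite: Gordon1999HodgeAVSurvey, 5.13 (ii) and §9.4] [cite: MoonenZarhin1999LowDim, Thm. 0.1] -/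
theorem mem_iff_or_of_isBalanced_of_isBalanced (hrank : Fintype.card E / 2 ≤ typeRank G Φ)
    {Ψ : Set E} (hΨ : ∀ x, x ∈ Ψ ↔ ρ • x ∉ Ψ) (hbal : IsBalanced G Φ (Ψ.indicator 1))
    {Ψ' : Set E} (hΨ' : ∀ x, x ∈ Ψ' ↔ ρ • x ∉ Ψ') (hbal' : IsBalanced G Φ (Ψ'.indicator 1)) :
    (∀ x, x ∈ Ψ' ↔ x ∈ Ψ) ∨ (∀ x, x ∈ Ψ' ↔ x ∉ Ψ) := by
  classical
  rcases isEmpty_or_nonempty E with hE | hE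
  · exact Or.inl fun x => (IsEmpty.false x).elim
  -- the two sign vectors
  obtain ⟨e, he⟩ : ∃ e : E → ℚ, ∀ x, e x = if x ∈ Ψ then 1 else -1 := ⟨_, fun _ => rfl⟩
  obtain ⟨e', he'⟩ : ∃ e' : E → ℚ, ∀ x, e' x = if x ∈ Ψ' then 1 else -1 := ⟨_, fun _ => rfl⟩
  obtain ⟨-, he_anti, he_orth⟩ := h.sign_sub_isBalanced hΨ hbal he
  obtain ⟨-, he'_anti, he'_orth⟩ := h.sign_sub_isBalanced hΨ' hbal' he'
  -- the space they span consists of anti-invariant balanced weights, so has dimension `≤ 1`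
  set W : Submodule ℚ (E → ℚ) := Submodule.span ℚ {e, e'} with hW_def
  have hWanti : W ≤ antiWeights (E := E) ρ := by
    refine Submodule.span_le.2 ?_
    intro f hf
    simp only [Set.mem_insert_iff, Set.mem_singleton_iff] at hf
    rcases hf with rfl | rfl
    · exact he_anti
    · exact he'_anti
  have hWorth : ∀ w ∈ W, ∀ g : G, dotProduct w (antiVec Φ g) = 0 := by
    intro w hw g
    refine dotProduct_antiVec_eq_zero_of_mem_span (fun s hs g' => ?_) hw g
    simp only [Set.mem_insert_iff, Set.mem_singleton_iff] at hs
    rcases hs with rfl | rfl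
    · exact he_orth g'
    · exact he'_orth g'
  have hWbal : ∀ w ∈ W, IsBalanced G Φ w := fun w hw =>
    h.isBalanced_of_anti_of_orthogonal (hWanti hw) (hWorth w hw)
  have hdim := h.typeRank_add_finrank_le_of_balanced W hWanti hWbal
  have hW1 : Module.finrank ℚ W ≤ 1 := by omega
  -- hence `e' = c • e`
  obtain ⟨x₀⟩ := hE
  have he0 : e ≠ 0 := fun h0 => by
    have h1 := congrFun h0 x₀
    rw [he, Pi.zero_apply] at h1
    by_cases hx : x₀ ∈ Ψ
    · rw [if_pos hx] at h1; norm_num at h1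
    · rw [if_neg hx] at h1; norm_num at h1
  have heW : e ∈ W := Submodule.subset_span (Set.mem_insert _ _)
  have he'W : e' ∈ W := Submodule.subset_span (Set.mem_insert_of_mem _ (Set.mem_singleton _))
  have hle : (ℚ ∙ e) ≤ W := (Submodule.span_singleton_le_iff_mem _ _).2 heW
  have hspan : (ℚ ∙ e) = W := by
    refine Submodule.eq_of_le_of_finrank_eq hle (le_antisymm (Submodule.finrank_mono hle) ?_)
    rw [finrank_span_singleton he0]
    exact hW1
  obtain ⟨c, hc⟩ := Submodule.mem_span_singleton.1 (hspan ▸ he'W)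
  have hcx : ∀ x, c * e x = e' x := fun x => by
    have h1 := congrFun hc x
    simpa only [Pi.smul_apply, smul_eq_mul] using h1
  -- `c = ±1`, read off at `x₀`
  have hc1 : c = 1 ∨ c = -1 := by
    have h1 := hcx x₀
    rw [he, he'] at h1
    by_cases hx : x₀ ∈ Ψ
    · by_cases hx' : x₀ ∈ Ψ'
      · rw [if_pos hx, if_pos hx'] at h1; left; linarith
      · rw [if_pos hx, if_neg hx'] at h1; right; linarith
    · by_cases hx' : x₀ ∈ Ψ'
      · rw [if_neg hx, if_pos hx'] at h1; right; linarith
      · rw [if_neg hx, if_neg hx'] at h1; left; linarith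
  rcases hc1 with rfl | rfl
  · refine Or.inl fun x => ?_
    have h1 := hcx x
    rw [he, he', one_mul] at h1
    by_cases hx : x ∈ Ψ
    · rw [if_pos hx] at h1
      refine ⟨fun _ => hx, fun _ => ?_⟩
      by_contra hx'
      rw [if_neg hx'] at h1; norm_num at h1
    · rw [if_neg hx] at h1
      refine ⟨fun hx' => ?_, fun hx' => absurd hx' hx⟩
      rw [if_pos hx'] at h1; norm_num at h1
  · refine Or.inr fun x => ?_
    have h1 := hcx x
    rw [he, he'] at h1
    by_cases hx : x ∈ Ψ
    · rw [if_pos hx] at h1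
      refine ⟨fun hx' => ?_, fun hx' => absurd hx hx'⟩
      rw [if_pos hx'] at h1; norm_num at h1
    · rw [if_neg hx] at h1
      refine ⟨fun _ => hx, fun _ => ?_⟩
      by_contra hx'
      rw [if_neg hx'] at h1; norm_num at h1

/-! ### A balanced transversal is a block with two translates -/

/-- **A balanced transversal of a type of rank `≥ n` is a block with two translates.**  If `rank(Φ) ≥ n` and the
transversal `Ψ` satisfies Pohlmann's condition (9.2.1), then for every `g ∈ G` either `g • x ∈ Ψ ↔ x ∈ Ψ` for all
`x` (`g` stabilises `Ψ`), or `g • x ∈ Ψ ↔ x ∉ Ψ` for all `x` (`g` carries `Ψ` to `Ψ̄`): apply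
`mem_iff_or_of_isBalanced_of_isBalanced` to `Ψ' = g⁻¹Ψ`, balanced by `IsBalanced.comp_smul`.  For a primitive CM
type on an octic field (`four_le_typeRank_of_card_eq_eight`) this says: an exceptional weight `⟨Ψ⟩ ∈ B²(A_Φ)` has
only the two Galois conjugates `⟨Ψ⟩, ⟨Ψ̄⟩` — it is a Weil class of the quadratic field fixed by the stabiliser.
[cite: MoonenZarhin1999LowDim, Thm. 0.1] [cite: vanGeemen1994HodgeAV, 4.7 and Thm. 4.12] -/
theorem smul_mem_iff_or_of_isBalanced (hrank : Fintype.card E / 2 ≤ typeRank G Φ)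
    {Ψ : Set E} (hΨ : ∀ x, x ∈ Ψ ↔ ρ • x ∉ Ψ) (hbal : IsBalanced G Φ (Ψ.indicator 1)) (g : G) :
    (∀ x, g • x ∈ Ψ ↔ x ∈ Ψ) ∨ (∀ x, g • x ∈ Ψ ↔ x ∉ Ψ) := by
  have hΨ' : ∀ x, x ∈ ({x | g • x ∈ Ψ} : Set E) ↔ ρ • x ∉ ({x | g • x ∈ Ψ} : Set E) := fun x => by
    change g • x ∈ Ψ ↔ g • ρ • x ∉ Ψ
    rw [h.comm]
    exact hΨ (g • x)
  have hbal' : IsBalanced G Φ (({x | g • x ∈ Ψ} : Set E).indicator 1) := by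
    rw [indicator_preimage_smul]
    exact hbal.comp_smul g
  exact h.mem_iff_or_of_isBalanced_of_isBalanced hrank hΨ hbal hΨ' hbal'

/-- Set form: `g • Ψ = Ψ` or `g • Ψ = Ψᶜ` (`= ρ • Ψ`). [cite: MoonenZarhin1999LowDim, Thm. 0.1] -/
theorem smul_set_eq_or_of_isBalanced (hrank : Fintype.card E / 2 ≤ typeRank G Φ)
    {Ψ : Set E} (hΨ : ∀ x, x ∈ Ψ ↔ ρ • x ∉ Ψ) (hbal : IsBalanced G Φ (Ψ.indicator 1)) (g : G) :
    g • Ψ = Ψ ∨ g • Ψ = Ψᶜ := by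
  rcases h.smul_mem_iff_or_of_isBalanced hrank hΨ hbal g⁻¹ with h1 | h1
  · refine Or.inl (Set.ext fun x => ?_)
    rw [Set.mem_smul_set_iff_inv_smul_mem]
    exact h1 x
  · refine Or.inr (Set.ext fun x => ?_)
    rw [Set.mem_smul_set_iff_inv_smul_mem, Set.mem_compl_iff]
    exact h1 x

omit [Fintype E] in
/-- The complement of a transversal (a CM type as a set) is its conjugate type: `Ψᶜ = ρ • Ψ` ("`{φ₁ρ, …, φₙρ}`" is the
rest of the embeddings). [cite: Shimura1998, §18.1] -/
theorem compl_eq_rho_smul_of_transversal {Ψ : Set E} (hΨ : ∀ x, x ∈ Ψ ↔ ρ • x ∉ Ψ) : Ψᶜ = ρ • Ψ := by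
  ext x
  rw [Set.mem_compl_iff, Set.mem_smul_set_iff_inv_smul_mem]
  have hρ : ρ⁻¹ • x = ρ • x := by
    rw [inv_smul_eq_iff, h.invol]
  rw [hρ, h.rho_smul_mem_iff_of_transversal hΨ]

/-- **The stabiliser of a balanced transversal has index `2`** (rank `≥ n`, `E ≠ ∅`): `ρ` represents the other
coset — every `g` either stabilises `Ψ` or acts like `ρ` on the partition `{Ψ, Ψ̄}`.  In print: the subfield of the
Galois closure fixed by `Stab(Ψ)` is a quadratic field, imaginary since `ρ ∉ Stab(Ψ)`.
[cite: MoonenZarhin1999LowDim, Thm. 0.1 (1.4)] [cite: vanGeemen1994HodgeAV, 4.7] -/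
theorem index_stabilizer_eq_two_of_isBalanced [Nonempty E] (hrank : Fintype.card E / 2 ≤ typeRank G Φ)
    {Ψ : Set E} (hΨ : ∀ x, x ∈ Ψ ↔ ρ • x ∉ Ψ) (hbal : IsBalanced G Φ (Ψ.indicator 1)) :
    (MulAction.stabilizer G Ψ).index = 2 := by
  obtain ⟨x₀⟩ := (inferInstance : Nonempty E)
  have hρΨ := h.rho_smul_mem_iff_of_transversal hΨ
  rw [Subgroup.index_eq_two_iff]
  refine ⟨ρ, fun b => ?_⟩
  rw [MulAction.mem_stabilizer_set, MulAction.mem_stabilizer_set]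
  rcases h.smul_mem_iff_or_of_isBalanced hrank hΨ hbal b with hb | hb
  · -- `b` stabilises, `bρ` does not
    refine Or.inr ⟨hb, fun hbρ => ?_⟩
    have h1 := hbρ x₀
    rw [mul_smul, hb, hρΨ] at h1
    tauto
  · -- `b` flips, `bρ` stabilises
    refine Or.inl ⟨fun x => ?_, fun hb' => ?_⟩
    · rw [mul_smul, hb, hρΨ, not_not]
    · have h1 := hb x₀
      have h2 := hb' x₀
      tauto

/-- **On eight embeddings a primitive type has rank `≥ 4 = n`** (Ribet's `log₂`-bound `2|E| ≤ 2^{rank}`, the tree's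
`two_mul_card_le_two_pow_typeRank`): every PRIMITIVE CM type of an octic CM field is nondegenerate or degenerate by
exactly one, so the block theorems above apply to all simple CM abelian fourfolds.
[cite: Dodson1987, Thm. 1.0 (iii) (p. 51)] [cite: Gordon1999HodgeAVSurvey, §9.4] -/
theorem four_le_typeRank_of_card_eq_eight (hcard : Fintype.card E = 8)
    (hsep : ∀ x y : E, (∀ g : G, g • x ∈ Φ ↔ g • y ∈ Φ) → x = y) : 4 ≤ typeRank G Φ := by
  have h1 := h.two_mul_card_le_two_pow_typeRank hsep
  rw [hcard] at h1
  exact four_le_of_sixteen_le_two_pow h1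

/-- The block theorem for `|E| = 8` and a primitive type, hypothesis-free in the rank: for every balanced
transversal `Ψ` and every `g`, `g • x ∈ Ψ ↔ x ∈ Ψ` for all `x` or `g • x ∈ Ψ ↔ x ∉ Ψ` for all `x`.
[cite: MoonenZarhin1999LowDim, Thm. 0.1] [cite: vanGeemen1994HodgeAV, Thm. 4.12] -/
theorem smul_mem_iff_or_of_isBalanced_of_card_eq_eight (hcard : Fintype.card E = 8)
    (hsep : ∀ x y : E, (∀ g : G, g • x ∈ Φ ↔ g • y ∈ Φ) → x = y)
    {Ψ : Set E} (hΨ : ∀ x, x ∈ Ψ ↔ ρ • x ∉ Ψ) (hbal : IsBalanced G Φ (Ψ.indicator 1)) (g : G) :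
    (∀ x, g • x ∈ Ψ ↔ x ∈ Ψ) ∨ (∀ x, g • x ∈ Ψ ↔ x ∉ Ψ) :=
  h.smul_mem_iff_or_of_isBalanced (by rw [hcard]; exact h.four_le_typeRank_of_card_eq_eight hcard hsep) hΨ hbal g

/-- … and for two balanced transversals `Ψ, Ψ'` on eight embeddings (primitive type): `Ψ' = Ψ` or `Ψ' = Ψ̄`
pointwise. [cite: MoonenZarhin1999LowDim, Thm. 0.1] [cite: Gordon1999HodgeAVSurvey, 5.13 (ii)] -/
theorem mem_iff_or_of_isBalanced_of_card_eq_eight (hcard : Fintype.card E = 8)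
    (hsep : ∀ x y : E, (∀ g : G, g • x ∈ Φ ↔ g • y ∈ Φ) → x = y)
    {Ψ : Set E} (hΨ : ∀ x, x ∈ Ψ ↔ ρ • x ∉ Ψ) (hbal : IsBalanced G Φ (Ψ.indicator 1))
    {Ψ' : Set E} (hΨ' : ∀ x, x ∈ Ψ' ↔ ρ • x ∉ Ψ') (hbal' : IsBalanced G Φ (Ψ'.indicator 1)) :
    (∀ x, x ∈ Ψ' ↔ x ∈ Ψ) ∨ (∀ x, x ∈ Ψ' ↔ x ∉ Ψ) :=
  h.mem_iff_or_of_isBalanced_of_isBalanced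
    (by rw [hcard]; exact h.four_le_typeRank_of_card_eq_eight hcard hsep) hΨ hbal hΨ' hbal'

end IsCMTypeWith

end Literature.NumberTheory.ComplexMultiplication
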